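import Summits.AtomisticToContinuum.FouriersLaw.Theorems.EmbeddedDrudeMourreGreenKuboContinuationThermalFamily
import Literature.MathematicalPhysics.KineticTheory.TransportRegularityOfMixing
import Literature.MathematicalPhysics.KineticTheory.InfiniteChainCurrentPositiveType
import Literature.MathematicalPhysics.KineticTheory.InfiniteChainCorrelationContinuity
import Literature.MathematicalPhysics.KineticTheory.InfiniteChainGibbsInvariance
import Literature.MathematicalPhysics.KineticTheory.InfiniteChainGibbsExistenceShift
import HarnessLib

/-!
# `stub_heatableInfrastructure` — registered stub A of line `heated-measure-thermal-exponent`,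
# crux `EmbeddedDrudeMourre.GreenKuboContinuation` (item stmt-AtomisticToContinuum-12597)

Target `Summits/AtomisticToContinuum/FouriersLaw/Theorems/EmbeddedDrudeMourreGreenKuboContinuationHeatableInfrastructure.lean`
(`ledger propose --supports stmt-AtomisticToContinuum-12597`). The theorem name and signature of
`stub_heatableInfrastructure` are REGISTERED and stay verbatim.

## Content

For the pinned anharmonic chain `P = pinnedChain ω₂ lam β γ` (`U = ω₂q²/2 + lam q⁴/4`,
`V = r²/2 + βr⁴/4`, all four parameters `> 0`) there is ONE infinite-volume dynamics `D` with
`D.carrier = bmGood P` (the Buttà–Marchioro flow on its superstable set, extended by the identity)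
such that at every `T > 0` some DLR Gibbs state `μ_T` is shift-invariant, preserved by `D`, with
absolutely convergent space-summed current autocorrelation `C_T(t)` at every `t`, `t ↦ C_T(t)`
continuous and `|C_T(t)| ≤ C_T(0)`.

## Proof (pure assembly of landed infrastructure)

1. `D` from `OscillatorChain.exists_bmDynamics` (`s₁ = s₂ = 2`): carrier `bmGood`, identity off
   `bmGood`, preserves every superstable DLR state at every temperature.
2. `μ_T` from `OscillatorChain.exists_gibbsFamily_pinnedChain`: DLR + shift-invariant + BM (2.3).
3. Absolute convergence: `regularTransport_of_shiftInvariant` (thermal-family file).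
4. `|C| ≤ C(0)`: `InfiniteChainDynamics.currentCorrelation_positiveType_of_carrier_subset_bmGood`.
5. Continuity: exponential `ρ`-mixing (`stub_regularMixing` fed `stub_regularDLRUnique`) and
   summable fixed-time `L²` locality of `j₀ ∘ φ_t`, `h₀ ∘ φ_t` (`exists_summable_l2_locality`, as
   in `stub_regularTransport`) give Doyon's zero-wavenumber data `Z` with `Z.μ = μ_T`
   (`exists_zeroWavenumberData_of_clustering`); the summed truncated autocorrelation of `j₀` is
   continuous (`continuous_integral_count_cov_flow`, termwise continuity from
   `continuous_integral_bondCurrentZ_mul_flow`) and equals `C_T(t)` because the mean current of the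
   unique regular state vanishes (`inner_currentClass_koopman_eq_currentCorrelation`).
-/

noncomputable section

namespace Summit.AtomisticToContinuum.FouriersLaw.Theorems.GreenKuboContinuation.HeatedMeasureThermalExponent

open MeasureTheory Filter Set Topology
open Literature.MathematicalPhysics.KineticTheory.HeatConduction
open Summit.AtomisticToContinuum.FouriersLaw.Theorems.GreenKuboContinuation.TemperatureBlindVitaliHurwitz

/-- **Continuity of the summed current autocorrelation from (M) + (L).** Let `U ≥ 0` be measurable
and `V` an even non-negative polynomial of degree `≥ 2`; let `D` have carrier `𝒳₀ = bmGood P` and be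
the identity off `𝒳₀`; let `μ` be a DLR Gibbs state at `T`, shift-invariant, with BM's
superstability estimate (2.3), preserved by `D`, in a regular class with at most one element.
Assume (M) exponential `ρ`-mixing of `μ` between half-lines, (L) fixed-time `L²(μ)` locality of
`j₀ ∘ φ_t` and `h₀ ∘ φ_t` with summable rate, locally uniformly in `t`, and continuity in `t` of the
two-point functions of `j₀`. Then `t ↦ C_μ(t) = D.currentCorrelation μ t` is continuous on `ℝ`
(it is the summed truncated autocorrelation `Σ_x Cov_μ(j₀, (j₀ ∘ φ_t) ∘ τ_x)` of Doyon's
zero-wavenumber form, the mean current vanishing by momentum reversal of the unique regular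
state). [folklore] -/
theorem continuous_currentCorrelation_of_mixing_of_locality {P : OscillatorChain}
    (D : InfiniteChainDynamics P) {s₂ : ℕ} (h₂ : 1 ≤ s₂) (hU0 : ∀ r, 0 ≤ P.U r)
    (hUm : Measurable P.U) (hV : OscillatorChain.IsEvenPolyOfDegree P.V s₂)
    (hcar : D.carrier = P.bmGood)
    (hid : ∀ (t : ℝ) (σ : ChainConfig), σ ∉ P.bmGood → D.flow t σ = σ)
    {T : ℝ} {μ : Measure ChainConfig} (hG : P.IsChainGibbsMeasure T μ) (hS : IsShiftInvariant μ)
    (hss : P.HasSuperstabilityEstimate μ) (hD : D.PreservesMeasure μ)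
    (huniq : ∀ μ₁ μ₂ : Measure ChainConfig,
      P.IsChainGibbsMeasure T μ₁ → IsShiftInvariant μ₁ → P.HasSuperstabilityEstimate μ₁ →
      P.IsChainGibbsMeasure T μ₂ → IsShiftInvariant μ₂ → P.HasSuperstabilityEstimate μ₂ → μ₁ = μ₂)
    (hmix : ∃ C m : ℝ, 0 < m ∧ ∀ (a : ℤ) (n : ℕ) (f g : ChainConfig → ℝ),
      DependsOn f {i : ℤ | i ≤ a} → DependsOn g {i : ℤ | a + n ≤ i} → Measurable f → Measurable g →
      MemLp f 2 μ → MemLp g 2 μ →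
      |∫ σ, f σ * g σ ∂μ - (∫ σ, f σ ∂μ) * ∫ σ, g σ ∂μ| ≤
        C * Real.exp (-(m * n)) * (∫ σ, f σ ^ 2 ∂μ) ^ (1 / 2 : ℝ) * (∫ σ, g σ ^ 2 ∂μ) ^ (1 / 2 : ℝ))
    (hloc : ∀ a ∈ ({fun σ => P.bondCurrentZ σ 0, fun σ => P.energyDensityZ σ 0} : Set (ChainConfig → ℝ)),
      ∀ τ : ℝ, 0 ≤ τ → ∃ ε : ℕ → ℝ, (∀ n, 0 ≤ ε n) ∧ Summable ε ∧ ∀ t : ℝ, |t| ≤ τ → ∀ n : ℕ,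
        ∃ g : ChainConfig → ℝ, DependsOn g (Icc (-(n : ℤ) - 1) (n + 1)) ∧ Measurable g ∧
          MemLp g 2 μ ∧ Real.sqrt (∫ σ, (a (D.flow t σ) - g σ) ^ 2 ∂μ) ≤ ε n)
    (hcontj : ∀ x : ℤ, Continuous fun t : ℝ =>
      ∫ σ, P.bondCurrentZ σ 0 * P.bondCurrentZ (chainShift x (D.flow t σ)) 0 ∂μ) :
    Continuous (D.currentCorrelation μ) := by
  haveI : IsProbabilityMeasure μ := hss.1
  have hV0 : ∀ r, 0 ≤ P.V r := hV.choose_spec.2.2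
  have hτ : ∀ x : ℤ, MeasurePreserving (chainShift x) μ μ := hS.measurePreserving_chainShift
  -- the mixing constant may be taken non-negative
  obtain ⟨C, m, hm, hmix⟩ := hmix
  have hmix' : ∀ (a : ℤ) (n : ℕ) (f g : ChainConfig → ℝ),
      DependsOn f {i : ℤ | i ≤ a} → DependsOn g {i : ℤ | a + n ≤ i} → Measurable f → Measurable g →
      MemLp f 2 μ → MemLp g 2 μ →
      |∫ σ, f σ * g σ ∂μ - (∫ σ, f σ ∂μ) * ∫ σ, g σ ∂μ| ≤
        max C 0 * Real.exp (-(m * n)) * (∫ σ, f σ ^ 2 ∂μ) ^ (1 / 2 : ℝ) *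
          (∫ σ, g σ ^ 2 ∂μ) ^ (1 / 2 : ℝ) := by
    intro a n f g h1 h2 h3 h4 h5 h6
    refine (hmix a n f g h1 h2 h3 h4 h5 h6).trans ?_
    have hA : 0 ≤ (∫ σ, f σ ^ 2 ∂μ) ^ (1 / 2 : ℝ) :=
      Real.rpow_nonneg (integral_nonneg fun _ => sq_nonneg _) _
    have hB : 0 ≤ (∫ σ, g σ ^ 2 ∂μ) ^ (1 / 2 : ℝ) :=
      Real.rpow_nonneg (integral_nonneg fun _ => sq_nonneg _) _
    have hE : 0 ≤ Real.exp (-(m * n)) := Real.exp_nonneg _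
    have : C * Real.exp (-(m * n)) ≤ max C 0 * Real.exp (-(m * n)) :=
      mul_le_mul_of_nonneg_right (le_max_left _ _) hE
    exact mul_le_mul_of_nonneg_right (mul_le_mul_of_nonneg_right this hA) hB
  have hC : 0 ≤ max C 0 := le_max_right _ _
  -- Doyon's zero-wavenumber data of `μ`
  have hclust := D.integrable_cov_generators h₂ hU0 hUm hV hcar hid hS hss hD hC hm hmix' hloc
  obtain ⟨Z, hZμ, -, -⟩ :=
    D.exists_zeroWavenumberData_of_clustering h₂ hU0 hUm hV hcar hid hS hss hD hclust
  subst hZμ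
  -- continuity of the summed truncated autocorrelation of `j₀`
  have hcj := D.continuous_integral_count_cov_flow hcar hid hU0 hV0 hτ hD hC hm hmix'
    (measurable_bondCurrentZ P 0) P.dependsOn_bondCurrentZ_zero
    (hss.memLp_bondCurrentZ h₂ hU0 hUm hV 0 ENNReal.ofNat_ne_top)
    (hloc _ (Set.mem_insert _ _)) hcontj
  -- zero mean current, and identification with `C_μ`
  have hmean : ∫ σ, P.bondCurrentZ σ 0 ∂Z.μ = 0 :=
    OscillatorChain.integral_bondCurrentZ_eq_zero_of_regular_unique hG hS hss huniq 0
  refine hcj.congr fun t => ?_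
  have h := Z.inner_currentClass_koopman_eq_currentCorrelation hmean t
  rw [Z.inner_currentClass_koopman] at h
  exact h

/-- **Stub A — `HeatableInfrastructure`** of line `heated-measure-thermal-exponent` (registered
signature, verbatim). For `pinnedChain ω₂ lam β γ` (all `> 0`) there is an infinite-volume dynamics
`D` whose carrier is the Buttà–Marchioro superstable set `𝒳₀ = bmGood` (the BM flow of
`OscillatorChain.exists_bmDynamics`, identity off `𝒳₀`) such that for every `T > 0` some DLR Gibbs
state `μ_T` is shift-invariant and preserved by `D` (the transfer-operator Markov state of
`OscillatorChain.exists_gibbsFamily_pinnedChain`; invariance of superstable DLR states under the BM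
flow), with absolutely convergent summed current autocorrelation `C_T(t)` at every `t`
(`regularTransport_of_shiftInvariant`), `t ↦ C_T(t)` continuous
(`continuous_currentCorrelation_of_mixing_of_locality`: exponential `ρ`-mixing + fixed-time `L²`
locality of the evolved generators) and `|C_T(t)| ≤ C_T(0)` (positive type,
`currentCorrelation_positiveType_of_carrier_subset_bmGood`).
[cite: ButtaMarchioro2016, §2 Thm 2.1–2.2 and eq. (2.6)] -/
theorem stub_heatableInfrastructure :
    ∀ ω₂ lam β γ : ℝ, 0 < ω₂ → 0 < lam → 0 < β → 0 < γ →
      ∃ D : InfiniteChainDynamics (pinnedChain ω₂ lam β γ),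
        D.carrier = (pinnedChain ω₂ lam β γ).bmGood ∧
        ∀ T : ℝ, 0 < T → ∃ μ : Measure ChainConfig,
          ((pinnedChain ω₂ lam β γ).IsChainGibbsMeasure T μ ∧ IsShiftInvariant μ ∧ D.PreservesMeasure μ ∧
          (∀ t : ℝ, D.HasAbsConvergentCorrelation μ t) ∧ Continuous (D.currentCorrelation μ) ∧
          ∀ t : ℝ, |D.currentCorrelation μ t| ≤ D.currentCorrelation μ 0) := by
  intro ω₂ lam β γ hω hl hβ hγ
  -- the chain data
  have hU1 : OscillatorChain.IsEvenPolyOfDegree (pinnedChain ω₂ lam β γ).U 2 :=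
    OscillatorChain.pinnedChain_isEvenPolyOfDegree_U β γ hω.le hl
  have hV1 : OscillatorChain.IsEvenPolyOfDegree (pinnedChain ω₂ lam β γ).V 2 :=
    OscillatorChain.pinnedChain_isEvenPolyOfDegree_V ω₂ lam γ hβ
  have hU0 : ∀ r, 0 ≤ (pinnedChain ω₂ lam β γ).U r := OscillatorChain.pinnedChain_U_nonneg β γ hω.le hl.le
  have hV0 : ∀ r, 0 ≤ (pinnedChain ω₂ lam β γ).V r := hV1.choose_spec.2.2
  have hU : ContDiff ℝ 2 (pinnedChain ω₂ lam β γ).U := hU1.contDiff_two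
  have hV : ContDiff ℝ 2 (pinnedChain ω₂ lam β γ).V := hV1.contDiff_two
  have hUm : Measurable (pinnedChain ω₂ lam β γ).U := hU.continuous.measurable
  have hVm : Measurable (pinnedChain ω₂ lam β γ).V := hV.continuous.measurable
  have hB1 : (pinnedChain ω₂ lam β γ).CondB1 :=
    OscillatorChain.condB1_of_bddBelow _ hU hV ⟨0, by rintro _ ⟨q, rfl⟩; exact hU0 q⟩
      ⟨0, by rintro _ ⟨r, rfl⟩; exact hV0 r⟩
  -- 1. ONE dynamics: the Buttà–Marchioro flow on `bmGood`, identity off `bmGood`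
  obtain ⟨D, hcar, -, hid, -, -, -, hpres⟩ :=
    OscillatorChain.exists_bmDynamics (P := pinnedChain ω₂ lam β γ) (s₁ := 2) (s₂ := 2)
      (by norm_num) (by norm_num) hU1 hV1
  refine ⟨D, hcar, fun T hT => ?_⟩
  -- 2. the heated state at `T`
  obtain ⟨μf, hμf⟩ := OscillatorChain.exists_gibbsFamily_pinnedChain γ hω hl.le hβ.le
  obtain ⟨hG, hS, hss⟩ := hμf T hT
  haveI : IsProbabilityMeasure (μf T) := hss.1
  have hD : D.PreservesMeasure (μf T) := hpres T (μf T) hG hss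
  -- 3. absolutely convergent correlations
  obtain ⟨hAC, -⟩ := regularTransport_of_shiftInvariant hω hl hβ hγ D hcar hT hG hS hD
  -- 4. `|C| ≤ C(0)`
  obtain ⟨-, hbd, -⟩ := D.currentCorrelation_positiveType_of_carrier_subset_bmGood (by norm_num)
    (by norm_num) hU1 hV1 hss hS hcar.subset hD hAC
  refine ⟨μf T, hG, hS, hD, hAC, ?_, hbd⟩
  -- 5. continuity: (M) mixing, (L) locality, termwise continuity
  have huniq := stub_regularDLRUnique ω₂ lam β γ hω hl hβ hγ T hT
  have hmix := stub_regularMixing ω₂ lam β γ hω hl hβ hγ T hT huniq (μf T) hG hS hss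
  have hsev : ∀ (n : ℕ) (t : ℝ), MeasurePreserving
      (OscillatorChain.severedFlow hB1 (Finset.Icc ((0 : ℤ) - n) ((0 : ℤ) + n)) t) (μf T) (μf T) :=
    fun n t => OscillatorChain.measurePreserving_severedFlow_of_isChainGibbsMeasure hU hV hB1 _ hG t
  have hpow4 : ∀ {a : ChainConfig → ℝ}, MemLp a 4 (μf T) → Integrable (fun σ => a σ ^ 4) (μf T) := by
    intro a h4
    have h := h4.integrable_norm_pow' (p := 4)
    refine h.congr (Eventually.of_forall fun σ => ?_)
    simp only [Real.norm_eq_abs]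
    exact Even.pow_abs (by decide) _
  have hloc : ∀ a ∈ ({fun σ => (pinnedChain ω₂ lam β γ).bondCurrentZ σ 0,
      fun σ => (pinnedChain ω₂ lam β γ).energyDensityZ σ 0} : Set (ChainConfig → ℝ)),
      ∀ τ : ℝ, 0 ≤ τ → ∃ ε : ℕ → ℝ, (∀ n, 0 ≤ ε n) ∧ Summable ε ∧ ∀ t : ℝ, |t| ≤ τ → ∀ n : ℕ,
        ∃ g : ChainConfig → ℝ, DependsOn g (Icc (-(n : ℤ) - 1) (n + 1)) ∧ Measurable g ∧
          MemLp g 2 (μf T) ∧ Real.sqrt (∫ σ, (a (D.flow t σ) - g σ) ^ 2 ∂(μf T)) ≤ ε n := by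
    intro a ha τ hτ
    have hdata : Measurable a ∧ DependsOn a (Icc (-1 : ℤ) 1) ∧ MemLp a 2 (μf T) ∧
        Integrable (fun σ => a σ ^ 4) (μf T) ∧ ∃ (Ca : ℝ) (da : ℕ), 0 ≤ Ca ∧
          ∀ (σ σ' : ChainConfig) (R δ : ℝ), 1 ≤ R → 0 ≤ δ → δ ≤ 1 →
            (∀ i : ℤ, -1 ≤ i → i ≤ 1 → |(σ' i).1| ≤ R ∧ |(σ' i).2| ≤ R ∧
              |(σ i).1 - (σ' i).1| ≤ δ ∧ |(σ i).2 - (σ' i).2| ≤ δ) → |a σ - a σ'| ≤ Ca * R ^ da * δ := by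
      rcases ha with rfl | rfl
      · obtain ⟨Ca, hCa, hL⟩ := OscillatorChain.exists_polyLipschitz_bondCurrentZ hV1
        exact ⟨measurable_bondCurrentZ _ 0, OscillatorChain.dependsOn_bondCurrentZ_zero _,
          hss.memLp_bondCurrentZ (by norm_num) hU0 hUm hV1 0 ENNReal.ofNat_ne_top,
          hpow4 (hss.memLp_bondCurrentZ (by norm_num) hU0 hUm hV1 0 ENNReal.ofNat_ne_top),
          Ca, 2 * 2 + 1, hCa, hL⟩
      · obtain ⟨Ca, hCa, hL⟩ := OscillatorChain.exists_polyLipschitz_energyDensityZ hU1 hV1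
        exact ⟨OscillatorChain.measurable_energyDensityZ _ hUm hVm 0,
          OscillatorChain.dependsOn_energyDensityZ_zero _,
          hss.memLp_energyDensityZ hU0 hV0 hUm hVm 0 ENNReal.ofNat_ne_top,
          hpow4 (hss.memLp_energyDensityZ hU0 hV0 hUm hVm 0 ENNReal.ofNat_ne_top),
          Ca, 2 * 2 + 2 * 2 + 1, hCa, hL⟩
    obtain ⟨ham, had, ha2, ha4, Ca, da, hCa, hL⟩ := hdata
    obtain ⟨ε, hε0, hε, hmain⟩ := D.exists_summable_l2_locality (by norm_num) (by norm_num) hU1 hV1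
      hcar hB1 hss hD hsev ham had ha2 ha4 hCa hL τ hτ
    refine ⟨ε, hε0, hε, fun t ht n => ?_⟩
    obtain ⟨h1, h2, h3, h4⟩ := hmain t ht n
    exact ⟨_, h1, h2, h3, h4⟩
  have hcontj : ∀ x : ℤ, Continuous fun t : ℝ => ∫ σ, (pinnedChain ω₂ lam β γ).bondCurrentZ σ 0 *
      (pinnedChain ω₂ lam β γ).bondCurrentZ (chainShift x (D.flow t σ)) 0 ∂(μf T) := by
    intro x
    simp only [OscillatorChain.bondCurrentZ_chainShift]
    exact D.continuous_integral_bondCurrentZ_mul_flow hss (by norm_num) hU0 hUm hV1 hD (0 + x) 0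
  exact continuous_currentCorrelation_of_mixing_of_locality D (by norm_num) hU0 hUm hV1 hcar hid
    hG hS hss hD huniq hmix hloc hcontj

end Summit.AtomisticToContinuum.FouriersLaw.Theorems.GreenKuboContinuation.HeatedMeasureThermalExponent

end
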